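import Literature.Analysis.ODE.ComplexOverRealBasis
import HarnessLib

/-!
# Barrier two-point algebra: complex solutions over the monotone two-end real basis

Topic `Literature/Analysis/ODE` (namespace `Literature.Analysis.ODE`), continuing
`ComplexOverRealBasis.lean` (constant Wronskians, flux of a combination) and `BarrierBasis.lean`
(existence of the monotone basis). For the REAL equation `y″ = q(x) y` on `[α, β]` let `g, d` be the
real solutions normalised at the two ends, `g(α) = 1, g′(α) = 0`, `d(β) = 1, d′(β) = 0`, with
Wronskian `g d′ − g′ d ≡ −w₀`, `w₀ = g′(β) ≠ 0`. Everything here is elementary and fully proved: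

* `eq_mul_add_of_left_data` / `eq_mul_add_of_right_data` — a COMPLEX solution `u` is the
  combination `u = a g + b d`, `u′ = a g′ + b d′` with coefficients read off from its data at the
  left end (`b w₀ = −u′(α)`, `a + b d(α) = u(α)`) or at the right end (`a w₀ = v′(β)`,
  `a g(β) + b = v(β)`); proved from the two constant Wronskians `u d′ − u′ d`, `u g′ − u′ g` and
  the nonvanishing determinant `g d′ − g′ d = −w₀` (no uniqueness theorem is invoked);
* `wronskian_of_combinations` — `W(a_u g + b_u d, a_v g + b_v d) = −(a_u b_v − b_u a_v) w₀`;
* `norm_mul_ofReal_add_le`, `four_term_bound_aux`, `abs_flux_combination_le` — the norm,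
  monotonicity and flux inequalities behind the two-point bound;
* `barrier_two_point` — the assembled statement on a barrier (`g ≥ 1` non-decreasing, `d ≥ 1`
  non-increasing, `w₀ > 0`): representations of the two solutions `u` (data at `α`) and `v` (data
  at `β`), the Wronskian factorisation, the four-term bound
  `|u(x)||v(x′)| ≤ |a_u||a_v| g(x′)² + |a_u||b_v| g(x′)d(x′) + |b_u||a_v| d(α)g(β) + |b_u||b_v| d(x)²`
  for `x ≤ x′`, the flux ceilings `|Im(ū u′)(α)| ≤ |a_u||b_u| w₀`, `|Im(v̄ v′)(β)| ≤ |a_v||b_v| w₀`,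
  and the floor `(|a_u||b_v| − |b_u||a_v|) w₀ ≤ |W(u, v)|` ("the growing component cannot
  cancel").

Used for the cone Green-kernel bound inside the single potential barrier of Carter's radial
equation (near-extremal Kerr programme).

## References
* P. Hartman, *Ordinary Differential Equations* (SIAM Classics 38, 2002), Ch. XI §2 (Wronskian
  identities, variation of constants) and §6 (disconjugate equations, principal solutions).
  Key `Hartman2002`.
-/

noncomputable section

open Set
open scoped ComplexConjugate

namespace Literature.Analysis.ODE

/-! ### Representation of a complex solution over the two-end basis -/

/-- **Representation from data at the left end.** Let `u″ = q u` (complex) and `g, d` real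
solutions of `y″ = q y` on `[α, β]` with `g(α) = 1`, `g′(α) = 0` and constant Wronskian
`g d′ − g′ d = −w₀ ≠ 0`. If `b w₀ = −u′(α)` and `a + b d(α) = u(α)`, then `u = a g + b d` and
`u′ = a g′ + b d′` on `[α, β]` (the Wronskians `u d′ − u′ d`, `u g′ − u′ g` are constant and the
`2 × 2` system has determinant `−w₀`). [folklore] -/
theorem eq_mul_add_of_left_data {u u' : ℝ → ℂ} {g g' d d' q : ℝ → ℝ} {α β w₀ : ℝ}
    (hu : ∀ x ∈ Icc α β, HasDerivAt u (u' x) x ∧ HasDerivAt u' ((q x : ℂ) * u x) x)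
    (hg : ∀ x ∈ Icc α β, HasDerivAt g (g' x) x ∧ HasDerivAt g' (q x * g x) x)
    (hd : ∀ x ∈ Icc α β, HasDerivAt d (d' x) x ∧ HasDerivAt d' (q x * d x) x)
    (hgα : g α = 1) (hg'α : g' α = 0) (hw₀ : w₀ ≠ 0)
    (hW : ∀ x ∈ Icc α β, g x * d' x - g' x * d x = -w₀)
    {a b : ℂ} (hb : b * w₀ = -u' α) (ha : a + b * d α = u α) {x : ℝ} (hx : x ∈ Icc α β) :
    u x = a * g x + b * d x ∧ u' x = a * g' x + b * d' x := by
  have hα : α ∈ Icc α β := left_mem_Icc.2 (hx.1.trans hx.2)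
  -- the two constant Wronskians against the real solutions, evaluated at `α`
  have hA := wronskian_complex_real_const hu hd hx
  have hB := wronskian_complex_real_const hu hg hx
  rw [hgα, hg'α] at hB
  simp only [Complex.ofReal_one, Complex.ofReal_zero, mul_one, mul_zero, zero_sub] at hB
  -- the determinant at `x` and `d′(α) = −w₀`
  have hWx : (g x : ℂ) * d' x - g' x * d x = -w₀ := by exact_mod_cast hW x hx
  have hWα : (d' α : ℂ) = -w₀ := by
    have h := hW α hα
    rw [hgα, hg'α, one_mul, zero_mul, sub_zero] at h
    exact_mod_cast h
  have hw : (w₀ : ℂ) ≠ 0 := Complex.ofReal_ne_zero.2 hw₀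
  constructor
  · refine mul_right_cancel₀ hw ?_
    linear_combination u x * hWx - (g x : ℂ) * hA + (d x : ℂ) * hB - u α * g x * hWα
      - (g x : ℂ) * w₀ * ha + ((d α : ℂ) * g x - d x) * hb
  · refine mul_right_cancel₀ hw ?_
    linear_combination u' x * hWx - (g' x : ℂ) * hA + (d' x : ℂ) * hB - u α * g' x * hWα
      - (g' x : ℂ) * w₀ * ha + ((d α : ℂ) * g' x - d' x) * hb

/-- **Representation from data at the right end.** Let `v″ = q v` (complex) and `g, d` real
solutions of `y″ = q y` on `[α, β]` with `d(β) = 1`, `d′(β) = 0`, `g′(β) = w₀ ≠ 0` and constant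
Wronskian `g d′ − g′ d = −w₀`. If `a w₀ = v′(β)` and `a g(β) + b = v(β)`, then `v = a g + b d` and
`v′ = a g′ + b d′` on `[α, β]`. [folklore] -/
theorem eq_mul_add_of_right_data {v v' : ℝ → ℂ} {g g' d d' q : ℝ → ℝ} {α β w₀ : ℝ}
    (hv : ∀ x ∈ Icc α β, HasDerivAt v (v' x) x ∧ HasDerivAt v' ((q x : ℂ) * v x) x)
    (hg : ∀ x ∈ Icc α β, HasDerivAt g (g' x) x ∧ HasDerivAt g' (q x * g x) x)
    (hd : ∀ x ∈ Icc α β, HasDerivAt d (d' x) x ∧ HasDerivAt d' (q x * d x) x)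
    (hdβ : d β = 1) (hd'β : d' β = 0) (hg'β : g' β = w₀) (hw₀ : w₀ ≠ 0)
    (hW : ∀ x ∈ Icc α β, g x * d' x - g' x * d x = -w₀)
    {a b : ℂ} (ha : a * w₀ = v' β) (hb : a * g β + b = v β) {x : ℝ} (hx : x ∈ Icc α β) :
    v x = a * g x + b * d x ∧ v' x = a * g' x + b * d' x := by
  have hβ : β ∈ Icc α β := right_mem_Icc.2 (hx.1.trans hx.2)
  -- the two constant Wronskians against the real solutions, transported from `x` to `β`
  have hA := (wronskian_complex_real_const hv hd hx).trans
    (wronskian_complex_real_const hv hd hβ).symm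
  have hB := (wronskian_complex_real_const hv hg hx).trans
    (wronskian_complex_real_const hv hg hβ).symm
  rw [hdβ, hd'β] at hA
  simp only [Complex.ofReal_one, Complex.ofReal_zero, mul_one, mul_zero, zero_sub] at hA
  rw [hg'β] at hB
  have hWx : (g x : ℂ) * d' x - g' x * d x = -w₀ := by exact_mod_cast hW x hx
  have hw : (w₀ : ℂ) ≠ 0 := Complex.ofReal_ne_zero.2 hw₀
  constructor
  · refine mul_right_cancel₀ hw ?_
    linear_combination v x * hWx - (g x : ℂ) * hA + (d x : ℂ) * hB
      + ((g β : ℂ) * d x - g x) * ha - (d x : ℂ) * w₀ * hb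
  · refine mul_right_cancel₀ hw ?_
    linear_combination v' x * hWx - (g' x : ℂ) * hA + (d' x : ℂ) * hB
      + ((g β : ℂ) * d' x - g' x) * ha - (d' x : ℂ) * w₀ * hb

/-! ### Algebraic and metric lemmas -/

/-- **Wronskian of two combinations**: if `G D′ − G′ D = −W` then
`(a_u G + b_u D)(a_v G′ + b_v D′) − (a_u G′ + b_u D′)(a_v G + b_v D) = −(a_u b_v − b_u a_v) W`.
[folklore] -/
theorem wronskian_of_combinations (au bu av bv G G' D D' W : ℂ) (hW : G * D' - G' * D = -W) :
    (au * G + bu * D) * (av * G' + bv * D') - (au * G' + bu * D') * (av * G + bv * D) =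
      -(au * bv - bu * av) * W := by
  linear_combination (au * bv - bu * av) * hW

/-- `‖a G + b D‖ ≤ ‖a‖ G + ‖b‖ D` for complex `a, b` and reals `G, D ≥ 0`. [folklore] -/
theorem norm_mul_ofReal_add_le (a b : ℂ) {G D : ℝ} (hG : 0 ≤ G) (hD : 0 ≤ D) :
    ‖a * G + b * D‖ ≤ ‖a‖ * G + ‖b‖ * D := by
  calc ‖a * G + b * D‖ ≤ ‖a * G‖ + ‖b * D‖ := norm_add_le _ _
    _ = ‖a‖ * G + ‖b‖ * D := by
        rw [norm_mul, norm_mul, Complex.norm_of_nonneg hG, Complex.norm_of_nonneg hD]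

/-- The monotonicity step of the four-term bound: for nonnegative weights `A, B, C, D`, reals
`g₁ ≤ g₂`, `0 ≤ d₂ ≤ d₁ ≤ dα`, `0 ≤ g₂ ≤ gβ`,
`(A g₁ + B d₁)(C g₂ + D d₂) ≤ A C g₂² + A D g₂ d₂ + B C dα gβ + B D d₁²`. [folklore] -/
theorem four_term_bound_aux {A B C D g₁ g₂ d₁ d₂ dα gβ : ℝ} (hA : 0 ≤ A) (hB : 0 ≤ B)
    (hC : 0 ≤ C) (hD : 0 ≤ D) (hd₁ : 0 ≤ d₁) (hg₂ : 0 ≤ g₂) (hd₂ : 0 ≤ d₂)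
    (hg : g₁ ≤ g₂) (hd : d₂ ≤ d₁) (hdα : d₁ ≤ dα) (hgβ : g₂ ≤ gβ) :
    (A * g₁ + B * d₁) * (C * g₂ + D * d₂) ≤
      A * C * g₂ ^ 2 + A * D * (g₂ * d₂) + B * C * (dα * gβ) + B * D * d₁ ^ 2 := by
  have i1 : g₁ * g₂ ≤ g₂ ^ 2 := by rw [sq]; exact mul_le_mul_of_nonneg_right hg hg₂
  have i2 : g₁ * d₂ ≤ g₂ * d₂ := mul_le_mul_of_nonneg_right hg hd₂
  have i3 : d₁ * g₂ ≤ dα * gβ := mul_le_mul hdα hgβ hg₂ (hd₁.trans hdα)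
  have i4 : d₁ * d₂ ≤ d₁ ^ 2 := by rw [sq]; exact mul_le_mul_of_nonneg_left hd hd₁
  have j1 := mul_le_mul_of_nonneg_left i1 (mul_nonneg hA hC)
  have j2 := mul_le_mul_of_nonneg_left i2 (mul_nonneg hA hD)
  have j3 := mul_le_mul_of_nonneg_left i3 (mul_nonneg hB hC)
  have j4 := mul_le_mul_of_nonneg_left i4 (mul_nonneg hB hD)
  linarith [j1, j2, j3, j4]

/-- **Flux of a combination, bounded**: `|Im(conj(a g + b d)·(a g′ + b d′))| ≤ ‖a‖‖b‖·|g d′ − d g′|`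
(the flux equals `Im(ā b)·(g d′ − d g′)` and `|Im(ā b)| ≤ |ā b| = ‖a‖‖b‖`). [folklore] -/
theorem abs_flux_combination_le (a b : ℂ) (g g' d d' : ℝ) :
    |(conj (a * g + b * d) * (a * g' + b * d')).im| ≤ ‖a‖ * ‖b‖ * |g * d' - d * g'| := by
  rw [flux_of_combination, abs_mul]
  refine mul_le_mul_of_nonneg_right ?_ (abs_nonneg _)
  calc |(conj a * b).im| ≤ ‖conj a * b‖ := Complex.abs_im_le_norm _
    _ = ‖a‖ * ‖b‖ := by rw [norm_mul, Complex.norm_conj]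

/-! ### The assembled two-point statement on a barrier -/

/-- **Barrier two-point algebra.** On `[α, β]` let `g, d` be the monotone real basis of
`y″ = q y` (`g(α) = 1, g′(α) = 0`, `d(β) = 1, d′(β) = 0`, `g′(β) = w₀ > 0`, `g ≥ 1` non-decreasing,
`g′ ≥ 0`, `d ≥ 1` non-increasing, `d′ ≤ 0`, `g d′ − g′ d ≡ −w₀`; produced by
`exists_barrierBasis` when `q ≥ 0`), and let `u, v` be complex solutions. With the coefficients
`b_u = −u′(α)/w₀`, `a_u = u(α) − b_u d(α)`, `a_v = v′(β)/w₀`, `b_v = v(β) − a_v g(β)`: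
(1)–(2) `u = a_u g + b_u d`, `v = a_v g + b_v d` together with their derivatives;
(3) `u v′ − u′ v ≡ −(a_u b_v − b_u a_v) w₀`;
(4) for `x ≤ x′`: `|u(x)||v(x′)| ≤ |a_u||a_v| g(x′)² + |a_u||b_v| g(x′) d(x′) + |b_u||a_v| d(α) g(β)
  + |b_u||b_v| d(x)²`;
(5)–(6) the flux ceilings `|Im(ū u′)(α)| ≤ |a_u||b_u| w₀`, `|Im(v̄ v′)(β)| ≤ |a_v||b_v| w₀`;
(7) the floor `(|a_u||b_v| − |b_u||a_v|) w₀ ≤ |u(α) v′(α) − u′(α) v(α)|` — the growing components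
cannot cancel in the Wronskian. [cite: Hartman2002, Ch. XI §6] -/
theorem barrier_two_point {q g g' d d' : ℝ → ℝ} {u u' v v' : ℝ → ℂ} {α β w₀ : ℝ}
    (hαβ : α ≤ β) (hw₀ : 0 < w₀)
    (hg : ∀ x ∈ Icc α β, HasDerivAt g (g' x) x ∧ HasDerivAt g' (q x * g x) x)
    (hd : ∀ x ∈ Icc α β, HasDerivAt d (d' x) x ∧ HasDerivAt d' (q x * d x) x)
    (hgα : g α = 1) (hg'α : g' α = 0) (hdβ : d β = 1) (hd'β : d' β = 0) (hg'β : g' β = w₀)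
    (hsign : ∀ x ∈ Icc α β, 1 ≤ g x ∧ 0 ≤ g' x ∧ 1 ≤ d x ∧ d' x ≤ 0)
    (hgm : MonotoneOn g (Icc α β)) (hdm : AntitoneOn d (Icc α β))
    (hW : ∀ x ∈ Icc α β, g x * d' x - g' x * d x = -w₀)
    (hu : ∀ x ∈ Icc α β, HasDerivAt u (u' x) x ∧ HasDerivAt u' ((q x : ℂ) * u x) x)
    (hv : ∀ x ∈ Icc α β, HasDerivAt v (v' x) x ∧ HasDerivAt v' ((q x : ℂ) * v x) x)
    (au bu av bv : ℂ) (hbu : bu = -u' α / w₀) (hau : au = u α - bu * d α)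
    (hav : av = v' β / w₀) (hbv : bv = v β - av * g β) :
    (∀ x ∈ Icc α β, u x = au * g x + bu * d x ∧ u' x = au * g' x + bu * d' x) ∧
    (∀ x ∈ Icc α β, v x = av * g x + bv * d x ∧ v' x = av * g' x + bv * d' x) ∧
    (∀ x ∈ Icc α β, u x * v' x - u' x * v x = -(au * bv - bu * av) * w₀) ∧
    (∀ x ∈ Icc α β, ∀ x' ∈ Icc α β, x ≤ x' →
      ‖u x‖ * ‖v x'‖ ≤ ‖au‖ * ‖av‖ * g x' ^ 2 + ‖au‖ * ‖bv‖ * (g x' * d x') +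
        ‖bu‖ * ‖av‖ * (d α * g β) + ‖bu‖ * ‖bv‖ * d x ^ 2) ∧
    |(conj (u α) * u' α).im| ≤ ‖au‖ * ‖bu‖ * w₀ ∧
    |(conj (v β) * v' β).im| ≤ ‖av‖ * ‖bv‖ * w₀ ∧
    (‖au‖ * ‖bv‖ - ‖bu‖ * ‖av‖) * w₀ ≤ ‖u α * v' α - u' α * v α‖ := by
  have hw : (w₀ : ℂ) ≠ 0 := Complex.ofReal_ne_zero.2 hw₀.ne'
  have hα : α ∈ Icc α β := left_mem_Icc.2 hαβ
  have hβ : β ∈ Icc α β := right_mem_Icc.2 hαβ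
  -- the coefficient equations in polynomial form
  have hbu' : bu * w₀ = -u' α := by rw [hbu]; exact div_mul_cancel₀ _ hw
  have hau' : au + bu * d α = u α := by rw [hau]; ring
  have hav' : av * w₀ = v' β := by rw [hav]; exact div_mul_cancel₀ _ hw
  have hbv' : av * g β + bv = v β := by rw [hbv]; ring
  -- (1), (2): the representations
  have hU : ∀ x ∈ Icc α β, u x = au * g x + bu * d x ∧ u' x = au * g' x + bu * d' x :=
    fun x hx => eq_mul_add_of_left_data hu hg hd hgα hg'α hw₀.ne' hW hbu' hau' hx
  have hV : ∀ x ∈ Icc α β, v x = av * g x + bv * d x ∧ v' x = av * g' x + bv * d' x :=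
    fun x hx => eq_mul_add_of_right_data hv hg hd hdβ hd'β hg'β hw₀.ne' hW hav' hbv' hx
  -- (3): the Wronskian factorisation
  have hWuv : ∀ x ∈ Icc α β, u x * v' x - u' x * v x = -(au * bv - bu * av) * w₀ := by
    intro x hx
    have hWx : (g x : ℂ) * d' x - g' x * d x = -w₀ := by exact_mod_cast hW x hx
    rw [(hU x hx).1, (hU x hx).2, (hV x hx).1, (hV x hx).2]
    exact wronskian_of_combinations au bu av bv _ _ _ _ _ hWx
  refine ⟨hU, hV, hWuv, ?_, ?_, ?_, ?_⟩
  · -- (4): the four-term bound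
    intro x hx x' hx' hxx'
    obtain ⟨hgx, -, hdx, -⟩ := hsign x hx
    obtain ⟨hgx', -, hdx', -⟩ := hsign x' hx'
    have h1 : ‖u x‖ ≤ ‖au‖ * g x + ‖bu‖ * d x := by
      rw [(hU x hx).1]
      exact norm_mul_ofReal_add_le au bu (by linarith) (by linarith)
    have h2 : ‖v x'‖ ≤ ‖av‖ * g x' + ‖bv‖ * d x' := by
      rw [(hV x' hx').1]
      exact norm_mul_ofReal_add_le av bv (by linarith) (by linarith)
    have h0 : 0 ≤ ‖au‖ * g x + ‖bu‖ * d x :=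
      add_nonneg (mul_nonneg (norm_nonneg _) (by linarith)) (mul_nonneg (norm_nonneg _) (by linarith))
    calc ‖u x‖ * ‖v x'‖ ≤ (‖au‖ * g x + ‖bu‖ * d x) * (‖av‖ * g x' + ‖bv‖ * d x') :=
          mul_le_mul h1 h2 (norm_nonneg _) h0
      _ ≤ _ := four_term_bound_aux (norm_nonneg _) (norm_nonneg _) (norm_nonneg _) (norm_nonneg _)
          (by linarith) (by linarith) (by linarith) (hgm hx hx' hxx') (hdm hx hx' hxx')
          (hdm hα hx hx.1) (hgm hx' hβ hx'.2)
  · -- (5): flux ceiling at `α`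
    rw [(hU α hα).1, (hU α hα).2]
    calc |(conj (au * ↑(g α) + bu * ↑(d α)) * (au * ↑(g' α) + bu * ↑(d' α))).im|
          ≤ ‖au‖ * ‖bu‖ * |g α * d' α - d α * g' α| := abs_flux_combination_le au bu _ _ _ _
      _ = ‖au‖ * ‖bu‖ * w₀ := by
          rw [show g α * d' α - d α * g' α = -w₀ by linarith [hW α hα], abs_neg, abs_of_pos hw₀]
  · -- (6): flux ceiling at `β`
    rw [(hV β hβ).1, (hV β hβ).2]
    calc |(conj (av * ↑(g β) + bv * ↑(d β)) * (av * ↑(g' β) + bv * ↑(d' β))).im|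
          ≤ ‖av‖ * ‖bv‖ * |g β * d' β - d β * g' β| := abs_flux_combination_le av bv _ _ _ _
      _ = ‖av‖ * ‖bv‖ * w₀ := by
          rw [show g β * d' β - d β * g' β = -w₀ by linarith [hW β hβ], abs_neg, abs_of_pos hw₀]
  · -- (7): the floor on the Wronskian at `α`
    rw [hWuv α hα, norm_mul, norm_neg, Complex.norm_of_nonneg hw₀.le]
    refine mul_le_mul_of_nonneg_right ?_ hw₀.le
    rw [← norm_mul, ← norm_mul]
    exact norm_sub_norm_le _ _

end Literature.Analysis.ODE

end
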